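import Mathlib
import Summits.Ventures.HodgeRepro2.T5CyclotomicSubfieldRealSubfield

/-!
# `maximalRealSubfield F ≃ realSubfield`, THE DEGREE `[F⁺ : ℚ] = [F : ℚ] / 2`, AND `[⟨H_F, −1⟩ : H_F] = 2`

Tier-5 support N2 / N3 / §G-N4.2 (seat p3, gen 82). File 308 identified the maximal real subfield of a CM subfield
`F` of a CM field `L` Galois over `ℚ` with the intermediate field `realSubfield L F = fixedField (H_F ⊔ ⟨c⟩)` at the
level of subsets of `L`. This file packages the identification as a `ℚ`-algebra isomorphism and draws the degree
consequences:

* `realSubfieldHom`, **`realSubfieldEquiv : maximalRealSubfield F ≃+* realSubfield L F`**,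
  **`realSubfieldAlgEquiv : maximalRealSubfield F ≃ₐ[ℚ] realSubfield L F`** (`x ↦ x`);
* **`finrank_realSubfield_eq`**: `[realSubfield : ℚ] = [F⁺ : ℚ]`; **`two_mul_finrank_realSubfield`**:
  `2 [F⁺ : ℚ] = [F : ℚ]` (Mathlib's `IsQuadraticExtension F⁺ F` and the tower law);
* **`two_mul_card_quotient_sup`**: for `F ⊆ ℚ(ζₘ)`, `2 · #((ℤ/mℤ)ˣ / (H_F ⊔ ⟨−1⟩)) = #((ℤ/mℤ)ˣ / H_F)` — the index of
  `H_F` in `⟨H_F, −1⟩` is `2`, read off the degrees (files 301 and 308);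
* **`finrank_realSubfield_of_finrank_eq_six`**: the sextic case, `[F⁺ : ℚ] = 3` on the intermediate field.

§8(d): uses an L-value-free non-vanishing device: NO.
-/

open NumberField NumberField.IsCMField IsCyclotomicExtension.Rat Ideal IsDedekindDomain
  IsDedekindDomain.HeightOneSpectrum
open Summit.Ventures.HodgeRepro2.T5CMTypeGaloisDialect Summit.Ventures.HodgeRepro2.T5CyclotomicSubfieldInertiaDeg
  Summit.Ventures.HodgeRepro2.T5CyclotomicConjugation Summit.Ventures.HodgeRepro2.T5CyclotomicSubfieldCyclicInert
  Summit.Ventures.HodgeRepro2.T5CyclotomicSubfieldRealSubfield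

namespace Summit.Ventures.HodgeRepro2.T5CyclotomicSubfieldRealSubfieldEquiv

section Equiv

variable (L : Type*) [Field L] [NumberField L] [IsCMField L] [IsGalois ℚ L]
  (F : IntermediateField ℚ L) [IsCMField F] [Normal ℚ F]

/-- The inclusion `maximalRealSubfield F → realSubfield L F`, `x ↦ x` (file 308's membership identification). -/
noncomputable def realSubfieldHom : maximalRealSubfield F →+* realSubfield L F where
  toFun x := ⟨algebraMap F L x, (mem_realSubfield_iff_mem_maximalRealSubfield L F x).mpr x.2⟩
  map_one' := by
    ext
    simp
  map_mul' x y := by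
    ext
    simp
  map_zero' := by
    ext
    simp
  map_add' x y := by
    ext
    simp

/-- `realSubfieldHom x = x` in `L`. -/
theorem coe_realSubfieldHom (x : maximalRealSubfield F) :
    ((realSubfieldHom L F x : realSubfield L F) : L) = algebraMap F L x := rfl

/-- The inclusion is bijective. -/
theorem realSubfieldHom_bijective : Function.Bijective (realSubfieldHom L F) := by
  constructor
  · intro x y hxy
    have h := congrArg (fun z : realSubfield L F => (z : L)) hxy
    simp only [coe_realSubfieldHom] at h
    exact Subtype.ext ((algebraMap F L).injective h)
  · intro y
    have hyF : (y : L) ∈ F := realSubfield_le L F y.2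
    refine ⟨⟨⟨y, hyF⟩, (mem_realSubfield_iff_mem_maximalRealSubfield L F ⟨y, hyF⟩).mp y.2⟩, ?_⟩
    ext
    rfl

/-- **`maximalRealSubfield F ≃+* realSubfield L F`**, `x ↦ x`. -/
noncomputable def realSubfieldEquiv : maximalRealSubfield F ≃+* realSubfield L F :=
  RingEquiv.ofBijective (realSubfieldHom L F) (realSubfieldHom_bijective L F)

/-- `realSubfieldEquiv x = x` in `L`. -/
theorem coe_realSubfieldEquiv (x : maximalRealSubfield F) :
    ((realSubfieldEquiv L F x : realSubfield L F) : L) = algebraMap F L x := rfl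

/-- **`maximalRealSubfield F ≃ₐ[ℚ] realSubfield L F`** (every ring isomorphism of `ℚ`-algebras is `ℚ`-linear). -/
noncomputable def realSubfieldAlgEquiv : maximalRealSubfield F ≃ₐ[ℚ] realSubfield L F :=
  AlgEquiv.ofRingEquiv (f := realSubfieldEquiv L F) fun q => by
    rw [eq_ratCast (algebraMap ℚ (maximalRealSubfield F)) q, map_ratCast,
      eq_ratCast (algebraMap ℚ (realSubfield L F)) q]

/-- **`[realSubfield : ℚ] = [F⁺ : ℚ]`.** -/
theorem finrank_realSubfield_eq :
    Module.finrank ℚ (realSubfield L F) = Module.finrank ℚ (maximalRealSubfield F) :=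
  ((realSubfieldAlgEquiv L F).toLinearEquiv.finrank_eq).symm

omit [IsCMField L] [IsGalois ℚ L] [Normal ℚ F] in
/-- **`2 [F⁺ : ℚ] = [F : ℚ]`** (Mathlib's `IsQuadraticExtension (maximalRealSubfield F) F` and the tower law). -/
theorem two_mul_finrank_maximalRealSubfield :
    2 * Module.finrank ℚ (maximalRealSubfield F) = Module.finrank ℚ F := by
  have h := Module.finrank_mul_finrank ℚ (maximalRealSubfield F) F
  rw [Algebra.IsQuadraticExtension.finrank_eq_two (maximalRealSubfield F) F] at h
  omega

/-- **`2 [realSubfield : ℚ] = [F : ℚ]`.** -/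
theorem two_mul_finrank_realSubfield : 2 * Module.finrank ℚ (realSubfield L F) = Module.finrank ℚ F := by
  rw [finrank_realSubfield_eq, two_mul_finrank_maximalRealSubfield]

end Equiv

section Cyclotomic

variable (m : ℕ) [NeZero m] (L : Type*) [Field L] [NumberField L] [IsCyclotomicExtension {m} ℚ L] [IsCMField L]
  (F : IntermediateField ℚ L) [IsCMField F]

/-- **`2 · #((ℤ/mℤ)ˣ / (H_F ⊔ ⟨−1⟩)) = #((ℤ/mℤ)ˣ / H_F)`**: the index of `H_F` in `⟨H_F, −1⟩` is `2`, read off the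
degrees `[F : ℚ] = 2 [F⁺ : ℚ]` through files 301 and 308. -/
theorem two_mul_card_quotient_sup :
    2 * Nat.card ((ZMod m)ˣ ⧸ (zmodSubgroup m L F ⊔ Subgroup.zpowers (-1))) =
      Nat.card ((ZMod m)ˣ ⧸ zmodSubgroup m L F) := by
  haveI : IsGalois ℚ L := IsCyclotomicExtension.isGalois {m} ℚ L
  haveI : IsGalois ℚ F := T5CyclotomicUnramified.isGalois_intermediateField L m F
  rw [card_quotient_realSubfield m L F, card_quotient m L F, two_mul_finrank_realSubfield L F]

include m in
/-- **The sextic case: `[F⁺ : ℚ] = 3`** on the intermediate field `realSubfield`. -/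
theorem finrank_realSubfield_of_finrank_eq_six (h6 : Module.finrank ℚ F = 6) :
    Module.finrank ℚ (realSubfield L F) = 3 := by
  haveI : IsGalois ℚ L := IsCyclotomicExtension.isGalois {m} ℚ L
  haveI : IsGalois ℚ F := T5CyclotomicUnramified.isGalois_intermediateField L m F
  have h := two_mul_finrank_realSubfield L F
  rw [h6] at h
  omega

/-- **The sextic case: `#((ℤ/mℤ)ˣ / (H_F ⊔ ⟨−1⟩)) = 3`.** -/
theorem card_quotient_sup_of_finrank_eq_six (h6 : Module.finrank ℚ F = 6) :
    Nat.card ((ZMod m)ˣ ⧸ (zmodSubgroup m L F ⊔ Subgroup.zpowers (-1))) = 3 := by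
  haveI : IsGalois ℚ L := IsCyclotomicExtension.isGalois {m} ℚ L
  rw [card_quotient_realSubfield m L F, finrank_realSubfield_of_finrank_eq_six m L F h6]

end Cyclotomic

end Summit.Ventures.HodgeRepro2.T5CyclotomicSubfieldRealSubfieldEquiv
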